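import Summits.CriticalPhenomena.PercolationContinuityZ3.Theorems.PercNearOneGluingNoHeavyLowerTailSahiSlotCycleDecomp

/-!
# Cycle-weight sums over `Sym(κ)`: the identity `Σ_τ Π_c (1 + ω c) = Σ_τ [Π_c ω c + Σ_e Π_{c ≠ cycle of e} ω c]`
# (support file for the all-order charge monotonicity of the slot-pattern kernel)

Support file of the one-cut programme (crux `NoHeavyLowerTail`, stmt-CriticalPhenomena-4575; cell `prim-masterthm`, seat P3,
gen 29; `HIERARCHY.md` §36).  For a weight `ω` on the subsets of a finite type `κ` consider
* the multiplicative cycle sum `M_κ(ω) = Σ_{τ ∈ Sym κ} Π_{c ∈ cycles τ} ω c` and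
* the pointed one `P_κ(ω) = Σ_{τ ∈ Sym κ} Σ_{e ∈ κ} Π_{c ∈ cycles τ, c ≠ cycle of e} ω c` (the cycle through a marked point omitted).
From the two-sided gluing decomposition (`SahiSlot.sum_powerset_orbits`) both `M_κ(1 + ω)` and `M_κ(ω) + P_κ(ω)` equal
`Σ_{U ⊆ κ} |U|! · M_{Uᶜ}(ω|)` — for the first because `Sym U` has `|U|!` elements (`sum_prod_one_add_eq`), for the second because there are
`(|U| − 1)!` cyclic permutations of `U` (`CycleForm.card_fullCycles`) and `|U|` marked points (`sum_prod_add_sum_pointed_eq`) — whence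
**`sum_pointed_add_sum_prod`**: `P_κ(ω) + M_κ(ω) = M_κ(1 + ω)`.
With `ω = −w`, `w(c) ∈ {0,1}`, the right-hand side `Σ_τ Π_c (1 − w c)` is manifestly nonnegative and antitone in `w`; the
left-hand side is what the Lieb–Sahi insertion recursion produces for the slot-pattern kernel `SahiSlot.patternForm` with one pinned slot
(sequel).  No definitions (plain sums); everything proved; axioms standard. [this work]
-/

noncomputable section

namespace Summit.CriticalPhenomena.PercolationContinuityZ3.Theorems

open Finset Function Equiv Equiv.Perm
open Literature.Combinatorics.Sahi2008 Literature.Combinatorics.Sahi2008.CycleForm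

namespace SahiSlot

variable {κ : Type*} [Fintype κ] [DecidableEq κ]

/-- A product over the embedded outside cycles is a product over the cycles of `β` with the restricted weight. [folklore] -/
theorem prod_image_map_orbits (U : Finset κ) (β : Perm {x // x ∉ U}) (ω : Finset κ → ℝ) :
    ∏ c ∈ (orbits β).image (Finset.map (Embedding.subtype _)), ω c = ∏ c ∈ orbits β, ω (c.map (Embedding.subtype _)) := by
  rw [prod_image fun c₁ _ c₂ _ h => map_injective _ h]

/-! ### `M(1 + ω)` through the decomposition -/

/-- **`Σ_τ Π_c (1 + ω c) = Σ_U |U|! · M_{Uᶜ}(ω|)`** (expand the product over the cycles; a sub-collection of cycles with union `U`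
together with the rest is a permutation of `U` — `|U|!` of them — and a permutation of `Uᶜ`). [this work] -/
theorem sum_prod_one_add_eq (ω : Finset κ → ℝ) :
    ∑ τ : Perm κ, ∏ c ∈ orbits τ, (1 + ω c) =
      ∑ U : Finset κ, ((U.card.factorial : ℕ) : ℝ) *
        ∑ β : Perm {x // x ∉ U}, ∏ c ∈ orbits β, ω (c.map (Embedding.subtype _)) := by
  have h1 : ∀ τ : Perm κ, ∏ c ∈ orbits τ, (1 + ω c) =
      ∑ W ∈ (orbits τ).powerset, (fun (_ R : Finset (Finset κ)) => ∏ c ∈ R, ω c) W (orbits τ \ W) := by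
    intro τ
    have h := Finset.prod_add (fun _ => (1 : ℝ)) ω (orbits τ)
    simp only [prod_const_one, one_mul] at h
    exact h
  rw [sum_congr rfl fun τ _ => h1 τ, sum_powerset_orbits (fun (_ R : Finset (Finset κ)) => ∏ c ∈ R, ω c)]
  refine sum_congr rfl fun U _ => ?_
  simp only [prod_image_map_orbits]
  rw [sum_const, card_univ, Fintype.card_perm, Fintype.card_coe, nsmul_eq_mul]

/-! ### `M(ω) + P(ω)` through the decomposition -/

/-- With the weight `ν(W) = [W = ∅] + [W = {c}]·|c|` on sub-collections:
`Σ_{W ⊆ cycles τ} ν(W) Π_{cycles ∖ W} ω = Π_c ω c + Σ_e Π_{c ≠ cycle of e} ω c`. [this work] -/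
theorem sum_nu_mul_prod (ω : Finset κ → ℝ) (τ : Perm κ) :
    ∑ W ∈ (orbits τ).powerset,
        ((if W = ∅ then (1 : ℝ) else 0) + (if W.card = 1 then ((W.biUnion id).card : ℝ) else 0)) * ∏ c ∈ orbits τ \ W, ω c =
      ∏ c ∈ orbits τ, ω c + ∑ e : κ, ∏ c ∈ (orbits τ).erase (orbit τ e), ω c := by
  simp only [add_mul, sum_add_distrib, ite_mul, zero_mul, one_mul]
  congr 1
  · rw [sum_ite_eq' ((orbits τ).powerset) ∅ (fun W => ∏ c ∈ orbits τ \ W, ω c), if_pos (empty_mem_powerset _),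
      sdiff_empty]
  · -- the singletons `{c₀}`, `c₀` a cycle
    rw [← sum_filter, ← powersetCard_eq_filter, powersetCard_one, sum_map]
    simp only [Function.Embedding.coeFn_mk]
    have h2 : ∀ c₀ ∈ orbits τ,
        ((({c₀} : Finset (Finset κ)).biUnion id).card : ℝ) * ∏ c ∈ orbits τ \ {c₀}, ω c =
          ∑ e ∈ univ.filter (fun e => orbit τ e = c₀), ∏ c ∈ (orbits τ).erase (orbit τ e), ω c := by
      intro c₀ hc₀
      rw [singleton_biUnion, id, sdiff_singleton_eq_erase,
        sum_congr rfl fun e he => by rw [(mem_filter.1 he).2], sum_const, filter_orbit_eq_self hc₀, nsmul_eq_mul]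
    rw [sum_congr rfl fun c₀ hc₀ => h2 c₀ hc₀]
    exact sum_fiberwise_of_maps_to (fun e _ => orbit_mem_orbits τ e) _

omit [Fintype κ] in
/-- The embedded cycles of a permutation of `↥U` cover `U`. [folklore] -/
theorem biUnion_image_map_orbits (U : Finset κ) (α : Perm {x // x ∈ U}) :
    ((orbits α).image (Finset.map (Embedding.subtype _))).biUnion id = U := by
  ext x
  simp only [orbits, mem_biUnion, mem_image, mem_univ, true_and, id]
  constructor
  · rintro ⟨c, ⟨c', ⟨z, rfl⟩, rfl⟩, hx⟩
    obtain ⟨w, -, rfl⟩ := mem_map.1 hx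
    exact w.2
  · intro hx
    exact ⟨(orbit α ⟨x, hx⟩).map (Embedding.subtype _), ⟨orbit α ⟨x, hx⟩, ⟨⟨x, hx⟩, rfl⟩, rfl⟩,
      mem_map.2 ⟨⟨x, hx⟩, self_mem_orbit α _, rfl⟩⟩

/-- A permutation of a nonempty finite type has exactly one cycle iff all points lie on one cycle. [folklore] -/
theorem card_orbits_eq_one_iff {β : Type*} [Fintype β] [DecidableEq β] [Nonempty β] (γ : Perm β) :
    (orbits γ).card = 1 ↔ ∀ a b, SameCycle γ a b := by
  constructor
  · intro h a b
    obtain ⟨O, hO⟩ := card_eq_one.1 h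
    have ha : orbit γ a = O := mem_singleton.1 (hO ▸ orbit_mem_orbits γ a)
    have hb : orbit γ b = O := mem_singleton.1 (hO ▸ orbit_mem_orbits γ b)
    exact mem_orbit.1 ((ha.trans hb.symm) ▸ self_mem_orbit γ b)
  · intro h
    obtain ⟨a₀⟩ := (inferInstance : Nonempty β)
    refine card_eq_one.2 ⟨orbit γ a₀, ?_⟩
    unfold orbits
    ext O
    simp only [mem_image, mem_univ, true_and, mem_singleton]
    constructor
    · rintro ⟨x, rfl⟩
      exact orbit_eq_orbit_of_sameCycle (h x a₀)
    · rintro rfl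
      exact ⟨a₀, rfl⟩

/-- `Σ_{α ∈ Sym U} ν(cycles α) = |U|!` — one permutation without cycles if `U = ∅`, else `|U|` marked points times `(|U| − 1)!` cyclic
permutations. [this work] -/
theorem sum_nu_image_orbits (U : Finset κ) :
    ∑ α : Perm {x // x ∈ U},
        ((if (orbits α).image (Finset.map (Embedding.subtype _)) = ∅ then (1 : ℝ) else 0) +
          (if ((orbits α).image (Finset.map (Embedding.subtype _))).card = 1 then
            ((((orbits α).image (Finset.map (Embedding.subtype _))).biUnion id).card : ℝ) else 0)) =
      ((U.card.factorial : ℕ) : ℝ) := by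
  by_cases hU : U = ∅
  · subst hU
    have h0 : ∀ α : Perm {x // x ∈ (∅ : Finset κ)}, (orbits α).image (Finset.map (Embedding.subtype _)) = ∅ := by
      intro α
      unfold orbits
      have : (univ : Finset {x // x ∈ (∅ : Finset κ)}) = ∅ := by
        ext z
        exact absurd z.2 (Finset.notMem_empty _)
      rw [this, image_empty, image_empty]
    simp only [h0, if_true, card_empty, sum_const, card_univ, Fintype.card_perm, Fintype.card_coe,
      Nat.factorial_zero]
    norm_num
  · obtain ⟨u₀, hu₀⟩ := nonempty_iff_ne_empty.2 hU
    haveI : Nonempty {x // x ∈ U} := ⟨⟨u₀, hu₀⟩⟩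
    have hpt : ∀ α : Perm {x // x ∈ U},
        ((if (orbits α).image (Finset.map (Embedding.subtype _)) = ∅ then (1 : ℝ) else 0) +
          (if ((orbits α).image (Finset.map (Embedding.subtype _))).card = 1 then
            ((((orbits α).image (Finset.map (Embedding.subtype _))).biUnion id).card : ℝ) else 0)) =
        if α ∈ fullCycles U then (U.card : ℝ) else 0 := by
      intro α
      have hne' : (orbits α).image (Finset.map (Embedding.subtype _)) ≠ ∅ := by
        intro h
        have h' := biUnion_image_map_orbits U α
        rw [h, biUnion_empty] at h'
        exact hU h'.symm
      rw [if_neg hne', zero_add, biUnion_image_map_orbits, card_image_of_injective _ (map_injective _)]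
      exact if_congr ((card_orbits_eq_one_iff α).trans mem_fullCycles.symm) rfl rfl
    rw [Fintype.sum_congr _ _ hpt, ← sum_filter, filter_mem_eq_inter, univ_inter, sum_const, nsmul_eq_mul,
      card_fullCycles U ⟨u₀, hu₀⟩, ← Nat.cast_mul, Nat.mul_comm, Nat.mul_factorial_pred (card_pos.2 ⟨u₀, hu₀⟩).ne']

/-- **`M(ω) + P(ω) = Σ_U |U|! · M_{Uᶜ}(ω|)`**. [this work] -/
theorem sum_prod_add_sum_pointed_eq (ω : Finset κ → ℝ) :
    ∑ τ : Perm κ, ∏ c ∈ orbits τ, ω c + ∑ τ : Perm κ, ∑ e : κ, ∏ c ∈ (orbits τ).erase (orbit τ e), ω c =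
      ∑ U : Finset κ, ((U.card.factorial : ℕ) : ℝ) *
        ∑ β : Perm {x // x ∉ U}, ∏ c ∈ orbits β, ω (c.map (Embedding.subtype _)) := by
  rw [← sum_add_distrib, ← sum_congr rfl fun τ _ => sum_nu_mul_prod ω τ,
    sum_powerset_orbits (fun W R =>
      ((if W = ∅ then (1 : ℝ) else 0) + (if W.card = 1 then ((W.biUnion id).card : ℝ) else 0)) * ∏ c ∈ R, ω c)]
  refine sum_congr rfl fun U _ => ?_
  simp only [prod_image_map_orbits, ← mul_sum]
  rw [← sum_mul, sum_nu_image_orbits]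

/-- **THE CYCLE-WEIGHT IDENTITY**: `Σ_τ Σ_e Π_{c ≠ cycle of e} ω c + Σ_τ Π_c ω c = Σ_τ Π_c (1 + ω c)`. [this work] -/
theorem sum_pointed_add_sum_prod (ω : Finset κ → ℝ) :
    ∑ τ : Perm κ, ∑ e : κ, ∏ c ∈ (orbits τ).erase (orbit τ e), ω c + ∑ τ : Perm κ, ∏ c ∈ orbits τ, ω c =
      ∑ τ : Perm κ, ∏ c ∈ orbits τ, (1 + ω c) := by
  rw [add_comm, sum_prod_add_sum_pointed_eq, sum_prod_one_add_eq]

end SahiSlot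

end Summit.CriticalPhenomena.PercolationContinuityZ3.Theorems
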